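import Mathlib
import HarnessLib
import Literature.Probability.LatticeModels.CriticalFKIsingArmVanishes
import Literature.Probability.LatticeModels.CriticalFKIsingConnectionLawsBox
import Literature.Probability.LatticeModels.RandomClusterConditionalDomination
import Literature.Probability.LatticeModels.RandomClusterSuccessiveConditioning
import Literature.Probability.LatticeModels.RandomClusterEmbedding

/-!
# Two-box arm bound for the wired random-cluster measure of a finite piece of a graph:
# `φ¹_S(x₀ ↔ x₁) ≤ φ¹_{Λ₀}(x₀ ↔ ∂Λ₀) · φ¹_{Λ₁}(x₁ ↔ ∂Λ₁) · φ¹_S(Λ₀ ↔ Λ₁)`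

Topic `Literature/Probability/LatticeModels`. For the random-cluster measure
`φ¹_S = rcMeasure (finsetGraph G S) p q (wiredBoundary G S)` of a finite piece `S` of a locally
finite graph `G` with its inner vertex boundary wired (`0 ≤ p ≤ 1`, `q ≥ 1`), and sub-pieces
`Λ ⊆ S` with their inside edges `U = insideEdges G h` (`RandomClusterDomainMarkov`):

* `rcMeasure_real_pieceArm_inter_le_mul` — **the wired boundary condition is maximal, relative
  form** (Grimmett 2006, Lemma (4.13) with Lemma (4.14)(b); Duminil-Copin–Smirnov 2012, §6.1,
  "successive conditionings"): for `x ∈ Λ ⊆ S`, the arm event `A = {x ↔ ∂Λ}` of `Λ` read on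
  `ω ∩ U`, and every event `F` determined by the configuration off `U`,
  `φ¹_S(A ∩ F) ≤ φ¹_Λ(x ↔ ∂Λ) · φ¹_S(F)`: condition on the configuration `ξ` off `U`
  (`rcMeasure_real_inter_le_mul_of_cylinder_le`), dominate the conditional law of `ω ∩ U` by the
  spanning graph `⟨U⟩` wired on every vertex off the interior of `Λ`
  (`rcMeasure_real_inter_cylinder_le_mul_fromEdgeSet`), and identify the latter with `Λ` wired on
  `∂Λ` (`rcMeasure_real_restrictConfig_preimage_of_wired`).
* `rcMeasure_real_sitePair_le_mul_mul` — **two-piece arm bound** (the decoupling step of Kesten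
  1986, proof of Thm. 3 / Duminil-Copin–Hongler–Nolin 2011, Prop. 14): for disjoint `Λ₀ ∋ x₀`,
  `Λ₁ ∋ x₁`, `φ¹_S(x₀ ↔ x₁) ≤ φ¹_{Λ₀}(x₀ ↔ ∂Λ₀) φ¹_{Λ₁}(x₁ ↔ ∂Λ₁) φ¹_S(∃ v ∈ Λ₀, w ∈ Λ₁, v ↔ w)`:
  an open path from `x₀` to `x₁` produces an arm in each piece and, between its last visit to `Λ₀`
  and its next visit to `Λ₁`, an open path using no inside edge of either piece; condition
  successively on the configuration off each piece.
* `rcMeasure_real_sitePair_le_thetaWiredBox_sq_mul` — on `ℤ^d` with two disjoint translated boxes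
  `x₀ + Λ_N`, `x₁ + Λ_N ⊆ S`: `φ¹_S(x₀ ↔ x₁) ≤ φ¹_{Λ_N}(0 ↔ ∂Λ_N)² · φ¹_S(x₀ + Λ_N ↔ x₁ + Λ_N)`
  (translation invariance, `rcMeasure_real_siteArm_icc_shift_le_thetaWiredBox`).
* `prod_rcMeasure_real_le_iInter` — FKG for finitely many increasing events,
  `∏ᵢ φ(Aᵢ) ≤ φ(⋂ᵢ Aᵢ)` (Grimmett 2006, Thm. (3.8)).

Everything is proved; no definitions (events are written out in full).

## References

* G. Grimmett, *The Random-Cluster Model*, Springer (2006): Thm. (3.8) (FKG), §4.2 Lemma (4.13)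
  (domain Markov), Lemma (4.14)(b) (comparison of boundary conditions), §4.3 (automorphisms),
  Prop. (5.11). [Grimmett2006]
* H. Duminil-Copin, S. Smirnov, *Conformal invariance of lattice models*, Clay Math. Proc. 15
  (2012), §6.1. [DuminilCopinSmirnov2012Clay]
* H. Kesten, Probab. Theory Related Fields 73 (1986) 369–394, proof of Thm. 3. [Kesten1986]
-/

noncomputable section

namespace Literature.Probability.LatticeModels

open _root_.MeasureTheory Finset SimpleGraph
open Literature.Probability.Percolation Literature.Barriers.CriticalPhenomena

/-! ### FKG for finitely many increasing events -/

section FKG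

variable {V : Type*} [Fintype V] [DecidableEq V] (G : SimpleGraph V) [DecidableRel G.Adj]

/-- **FKG for finitely many increasing events**: `∏_{i ∈ s} φ(A_i) ≤ φ(⋂_{i ∈ s} A_i)` for the
random-cluster measure with `0 ≤ p ≤ 1`, `q ≥ 1` (iterate Grimmett 2006, Thm. (3.8)).
[cite: Grimmett2006, Thm. (3.8)] -/
theorem prod_rcMeasure_real_le_biInter {p q : ℝ} (hp : p ∈ Set.Icc (0 : ℝ) 1) (hq : 1 ≤ q)
    (B : Set V) {ι : Type*} (s : Finset ι) (A : ι → Set (BondConfig V))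
    (hA : ∀ i ∈ s, IsUpperSet (A i)) :
    ∏ i ∈ s, (rcMeasure G p q B).real (A i) ≤ (rcMeasure G p q B).real (⋂ i ∈ s, A i) := by
  classical
  have hq0 : 0 < q := one_pos.trans_le hq
  haveI := isProbabilityMeasure_rcMeasure G hp hq0 B
  induction s using Finset.induction_on with
  | empty => simp
  | insert a s ha ih =>
    have hA' : ∀ i ∈ s, IsUpperSet (A i) := fun i hi => hA i (Finset.mem_insert_of_mem hi)
    have hup : IsUpperSet (⋂ i ∈ s, A i) :=
      isUpperSet_iInter fun i => isUpperSet_iInter fun hi => hA' i hi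
    rw [Finset.prod_insert ha, Finset.set_biInter_insert]
    calc (rcMeasure G p q B).real (A a) * ∏ i ∈ s, (rcMeasure G p q B).real (A i)
        ≤ (rcMeasure G p q B).real (A a) * (rcMeasure G p q B).real (⋂ i ∈ s, A i) :=
          mul_le_mul_of_nonneg_left (ih hA') measureReal_nonneg
      _ ≤ _ := rcMeasure_fkg_holds G hp hq B (hA a (Finset.mem_insert_self a s)) hup

/-- **FKG for a finite family of increasing events**: `∏ᵢ φ(A_i) ≤ φ(⋂ᵢ A_i)`.
[cite: Grimmett2006, Thm. (3.8)] -/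
theorem prod_rcMeasure_real_le_iInter {p q : ℝ} (hp : p ∈ Set.Icc (0 : ℝ) 1) (hq : 1 ≤ q)
    (B : Set V) {ι : Type*} [Fintype ι] (A : ι → Set (BondConfig V)) (hA : ∀ i, IsUpperSet (A i)) :
    ∏ i, (rcMeasure G p q B).real (A i) ≤ (rcMeasure G p q B).real (⋂ i, A i) := by
  have h := prod_rcMeasure_real_le_biInter G hp hq B Finset.univ A fun i _ => hA i
  simpa only [Finset.mem_univ, Set.iInter_true] using h

end FKG

/-! ### Generic lemmas -/

/-- Events read off a part of the configuration outside `U` are determined off `U`. [folklore] -/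
private theorem inter_eq_inter_of_subset_compl' {E : Type*} {U T : Set E} (hT : T ⊆ Uᶜ)
    {ω₁ ω₂ : Set E} (h : ω₁ ∩ Uᶜ = ω₂ ∩ Uᶜ) : ω₁ ∩ T = ω₂ ∩ T := by
  have h1 : ω₁ ∩ T = (ω₁ ∩ Uᶜ) ∩ T := by rw [Set.inter_assoc, Set.inter_eq_right.2 hT]
  have h2 : ω₂ ∩ T = (ω₂ ∩ Uᶜ) ∩ T := by rw [Set.inter_assoc, Set.inter_eq_right.2 hT]
  rw [h1, h2, h]

/-- **First entrance into a set along a walk**: a walk ending in `P` reaches a vertex of `P` through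
edges each having an endpoint outside `P`. [folklore] -/
private theorem exists_mem_reachable_inf_fromRel' {W : Type*} {K : SimpleGraph W} (P : Set W)
    {u x : W} (p : K.Walk u x) (hx : x ∈ P) :
    ∃ v ∈ P, (K ⊓ fromRel fun a _ ↦ a ∉ P).Reachable u v := by
  induction p with
  | nil => exact ⟨_, hx, Reachable.refl _⟩
  | @cons a b c hab p ih =>
    by_cases ha : a ∈ P
    · exact ⟨a, ha, Reachable.refl _⟩
    · obtain ⟨v, hv, hreach⟩ := ih hx
      refine ⟨v, hv, (Adj.reachable ?_).trans hreach⟩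
      rw [inf_adj, fromRel_adj]
      exact ⟨hab, hab.ne, Or.inl ha⟩

/-- Arm events `{x ↔ ∂Λ}` are increasing. [folklore] -/
theorem isUpperSet_pieceArmEvent {V : Type*} [DecidableEq V] (G : SimpleGraph V) [G.LocallyFinite]
    (Λ : Finset V) (x : V) :
    IsUpperSet {ζ : BondConfig ↥Λ | ∃ a y : ↥Λ, a.1 = x ∧ y ∈ wiredBoundary G Λ ∧
      (openGraph ζ).Reachable a y} := by
  rintro ω ω' hle ⟨a, y, ha, hy, hreach⟩
  exact ⟨a, y, ha, hy, hreach.mono (fromEdgeSet_mono hle)⟩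

section Pieces

variable {V : Type*} {G : SimpleGraph V}

/-! ### Inside edges of a sub-piece -/

/-- The endpoints of an inside edge of `Λ ⊆ S` lie in `Λ`. [folklore] -/
theorem mem_of_mem_insideEdges [DecidableRel G.Adj] {Λ S : Finset V} (h : Λ ⊆ S) {e : Sym2 ↥S}
    (he : e ∈ insideEdges G h) {x : ↥S} (hx : x ∈ e) : x.1 ∈ Λ := by
  obtain ⟨e', -, rfl⟩ := Finset.mem_map.1 he
  induction e' using Sym2.ind with
  | h a b =>
    rw [edgeLift_mk] at hx
    rcases Sym2.mem_iff.1 hx with rfl | rfl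
    · exact a.2
    · exact b.2

/-- Two adjacent vertices of `S` inside `Λ` span an inside edge. [folklore] -/
theorem mk_mem_insideEdges [DecidableRel G.Adj] {Λ S : Finset V} (h : Λ ⊆ S) {a b : ↥S}
    (hab : (finsetGraph G S).Adj a b) (ha : a.1 ∈ Λ) (hb : b.1 ∈ Λ) :
    s(a, b) ∈ insideEdges G h := by
  have heq : s(a, b) = edgeLift h s(⟨a.1, ha⟩, ⟨b.1, hb⟩) := by rw [edgeLift_mk]; rfl
  rw [heq, edgeLift_mem_insideEdges_iff, mem_edgeFinset, mem_edgeSet, finsetGraph_adj_iff]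
  exact hab

/-- The inside edges of two disjoint sub-pieces are disjoint. [folklore] -/
theorem disjoint_insideEdges_of_disjoint [DecidableEq V] [DecidableRel G.Adj] {Λ₀ Λ₁ S : Finset V} (h₀ : Λ₀ ⊆ S) (h₁ : Λ₁ ⊆ S)
    (hdisj : Disjoint Λ₀ Λ₁) : Disjoint (insideEdges G h₀) (insideEdges G h₁) := by
  rw [Finset.disjoint_left]
  intro e he₀ he₁
  induction e using Sym2.ind with
  | h a b =>
    exact Finset.disjoint_left.1 hdisj (mem_of_mem_insideEdges h₀ he₀ (Sym2.mem_mk_left a b))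
      (mem_of_mem_insideEdges h₁ he₁ (Sym2.mem_mk_left a b))

/-- Edges of `S` off the inside edges of `Λ` have both endpoints in the environment set
`{v ∉ Λ} ∪ ∂Λ`. [folklore] -/
theorem mem_envSet_of_mem_sdiff_insideEdges [DecidableEq V] [DecidableRel G.Adj] [G.LocallyFinite] {Λ S : Finset V} (h : Λ ⊆ S) :
    ∀ e ∈ (finsetGraph G S).edgeFinset \ insideEdges G h, ∀ x ∈ e, x ∈ envSet G Λ S := by
  intro e he x hx
  induction e using Sym2.ind with
  | h a b =>
    have he' : s(a, b) ∈ outsideEdges G h := he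
    have hab := mem_envSet_of_mem_outsideEdges h he'
    rcases Sym2.mem_iff.1 hx with rfl | rfl
    · exact hab.1
    · exact hab.2

/-- The environment set of `Λ ⊆ S` is the wired boundary of the embedded `Λ` together with the
idle vertices (the wiring hypothesis of `rcMeasure_real_restrictConfig_preimage_of_wired`).
[folklore] -/
theorem mem_envSet_iff_forall_finsetInclEmb [DecidableEq V] [G.LocallyFinite] {Λ S : Finset V} (h : Λ ⊆ S) (u : ↥S) :
    u ∈ envSet G Λ S ↔ ∀ a : ↥Λ, finsetInclEmb h a = u → a ∈ wiredBoundary G Λ := by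
  constructor
  · rintro hu a rfl
    exact (finsetIncl_mem_envSet_iff h a).1 hu
  · intro hu
    by_cases huΛ : u.1 ∈ Λ
    · have hau : finsetInclEmb h ⟨u.1, huΛ⟩ = u := Subtype.ext rfl
      have := hu ⟨u.1, huΛ⟩ hau
      rw [← hau]
      exact (finsetIncl_mem_envSet_iff h _).2 this
    · exact Or.inl huΛ

/-! ### One piece: the wired boundary condition is maximal, relative form -/

/-- **The conditional probability of the arm in a sub-piece is at most its wired arm probability**
(Grimmett 2006, Lemma (4.13) with Lemma (4.14)(b)): for `Λ ⊆ S` with `∂Λ ≠ ∅` and inside edges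
`U`, every configuration `ξ` off `U`, and the event `A = {x ↔ ∂Λ}` of `Λ` read on `ω ∩ U`,
`φ¹_S(A ∩ {ω ∖ U = ξ}) ≤ φ¹_Λ(x ↔ ∂Λ) · φ¹_S({ω ∖ U = ξ})` (`0 ≤ p ≤ 1`, `q ≥ 1`).
[cite: Grimmett2006, Lemma (4.13) and Lemma (4.14)(b)] -/
theorem rcMeasure_real_pieceArm_inter_cylinder_le [DecidableEq V] [DecidableRel G.Adj] [G.LocallyFinite] {p q : ℝ} (hp : p ∈ Set.Icc (0 : ℝ) 1)
    (hq : 1 ≤ q) {Λ S : Finset V} (h : Λ ⊆ S) (hΛ : (wiredBoundary G Λ).Nonempty) (x : V)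
    (ξ : Finset (Sym2 ↥S)) (hξ : ξ ⊆ (finsetGraph G S).edgeFinset \ insideEdges G h) :
    (rcMeasure (finsetGraph G S) p q (wiredBoundary G S)).real
        ({ω | ω ∩ ↑(insideEdges G h) ∈ finsetRestrict h ⁻¹'
            {ζ | ∃ a y : ↥Λ, a.1 = x ∧ y ∈ wiredBoundary G Λ ∧ (openGraph ζ).Reachable a y}} ∩
          {ω | ω ∩ (↑(insideEdges G h) : Set (Sym2 ↥S))ᶜ = ↑ξ}) ≤
      (rcMeasure (finsetGraph G Λ) p q (wiredBoundary G Λ)).real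
          {ζ | ∃ a y : ↥Λ, a.1 = x ∧ y ∈ wiredBoundary G Λ ∧ (openGraph ζ).Reachable a y} *
        (rcMeasure (finsetGraph G S) p q (wiredBoundary G S)).real
          {ω | ω ∩ (↑(insideEdges G h) : Set (Sym2 ↥S))ᶜ = ↑ξ} := by
  classical
  have hq0 : 0 < q := one_pos.trans_le hq
  set U := insideEdges G h with hU
  set ARM : Set (BondConfig ↥Λ) :=
    {ζ | ∃ a y : ↥Λ, a.1 = x ∧ y ∈ wiredBoundary G Λ ∧ (openGraph ζ).Reachable a y} with hARM
  have hpre : IsUpperSet (finsetRestrict h ⁻¹' ARM) :=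
    fun ω₁ ω₂ hle h₁ => isUpperSet_pieceArmEvent G Λ x (fun e he => hle he) h₁
  -- identification of `⟨U⟩` wired on the environment set with `Λ` wired on its boundary
  have hE : ∀ i : Fintype (fromEdgeSet (↑U : Set (Sym2 ↥S))).edgeSet,
      @SimpleGraph.edgeFinset _ (fromEdgeSet (↑U : Set (Sym2 ↥S))) i =
        (finsetGraph G Λ).edgeFinset.map (finsetInclEmb h).sym2Map := fun i => by
    rw [@edgeFinset_fromEdgeSet_of_subset _ _ (finsetGraph G S) _ U (insideEdges_subset_edgeFinset h) i]
    rfl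
  have hident : (rcMeasure (fromEdgeSet (↑U : Set (Sym2 ↥S))) p q (envSet G Λ S)).real
      (finsetRestrict h ⁻¹' ARM) = (rcMeasure (finsetGraph G Λ) p q (wiredBoundary G Λ)).real ARM :=
    rcMeasure_real_restrictConfig_preimage_of_wired (finsetInclEmb h) (hE _) hp hq0 hΛ
      (mem_envSet_iff_forall_finsetInclEmb h) ARM
  have hξW : ∀ e ∈ (↑ξ : Set (Sym2 ↥S)), ∀ v ∈ e, v ∈ envSet G Λ S :=
    fun e he v hv => mem_envSet_of_mem_sdiff_insideEdges h e (hξ he) v hv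
  have key := rcMeasure_real_inter_cylinder_le_mul_fromEdgeSet _ hp hq (wiredBoundary G S) U
    (insideEdges_subset_edgeFinset h) (↑ξ) (wiredBoundary_subset_envSet h) hξW hpre
  rw [hident] at key
  exact key.trans_eq (mul_comm _ _)

/-- **The wired boundary condition is maximal, relative form** (Grimmett 2006, Lemma (4.13) with
Lemma (4.14)(b); Duminil-Copin–Smirnov 2012, §6.1): for `Λ ⊆ S` with `∂Λ ≠ ∅` and inside edges
`U`, the arm event `A = {x ↔ ∂Λ}` of `Λ` read on `ω ∩ U`, and every event `F` determined by the
configuration off `U`, `φ¹_S(A ∩ F) ≤ φ¹_Λ(x ↔ ∂Λ) · φ¹_S(F)` (`0 ≤ p ≤ 1`, `q ≥ 1`).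
[cite: Grimmett2006, Lemma (4.13) and Lemma (4.14)(b); DuminilCopinSmirnov2012Clay, §6.1] -/
theorem rcMeasure_real_pieceArm_inter_le_mul [DecidableEq V] [DecidableRel G.Adj] [G.LocallyFinite] {p q : ℝ} (hp : p ∈ Set.Icc (0 : ℝ) 1) (hq : 1 ≤ q)
    {Λ S : Finset V} (h : Λ ⊆ S) (hΛ : (wiredBoundary G Λ).Nonempty) (x : V) {F : Set (BondConfig ↥S)}
    (hF : ∀ ω₁ ω₂ : BondConfig ↥S,
      ω₁ ∩ (↑(insideEdges G h))ᶜ = ω₂ ∩ (↑(insideEdges G h))ᶜ → (ω₁ ∈ F ↔ ω₂ ∈ F)) :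
    (rcMeasure (finsetGraph G S) p q (wiredBoundary G S)).real
        ({ω | ω ∩ ↑(insideEdges G h) ∈ finsetRestrict h ⁻¹'
            {ζ | ∃ a y : ↥Λ, a.1 = x ∧ y ∈ wiredBoundary G Λ ∧ (openGraph ζ).Reachable a y}} ∩ F) ≤
      (rcMeasure (finsetGraph G Λ) p q (wiredBoundary G Λ)).real
          {ζ | ∃ a y : ↥Λ, a.1 = x ∧ y ∈ wiredBoundary G Λ ∧ (openGraph ζ).Reachable a y} *
        (rcMeasure (finsetGraph G S) p q (wiredBoundary G S)).real F :=
  rcMeasure_real_inter_le_mul_of_cylinder_le _ hp (one_pos.trans_le hq) (wiredBoundary G S)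
    (insideEdges G h) hF fun ξ hξ => rcMeasure_real_pieceArm_inter_cylinder_le hp hq h hΛ x ξ hξ

/-! ### Inclusions of events on configurations of the edges of `S` -/

/-- **An open path leaving the piece produces its arm, read on the inside edges**: if `ω ⊆ E_S`
joins a vertex `a` of `Λ ⊆ S` to a vertex outside `Λ`, then the restriction of `ω ∩ U` to `Λ` joins
`a` to `∂Λ`. [cite: Grimmett2006, Prop. (5.11) (proof)] -/
theorem inter_insideEdges_mem_pieceArm [DecidableEq V] [DecidableRel G.Adj] [G.LocallyFinite] {Λ S : Finset V} (h : Λ ⊆ S)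
    {ω : BondConfig ↥S} (hωE : ω ⊆ (finsetGraph G S).edgeSet) {a b : ↥S} (ha : a.1 ∈ Λ)
    (hb : b.1 ∉ Λ) (hab : (openGraph ω).Reachable a b) :
    ω ∩ ↑(insideEdges G h) ∈ finsetRestrict h ⁻¹'
      {ζ | ∃ a' y : ↥Λ, a'.1 = a.1 ∧ y ∈ wiredBoundary G Λ ∧ (openGraph ζ).Reachable a' y} := by
  have hax : a = finsetIncl h ⟨a.1, ha⟩ := Subtype.ext rfl
  rw [hax] at hab
  obtain ⟨z, hz, hxz⟩ := exists_reachable_wiredBoundary_restrict_of_notMem h hωE hb hab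
  refine ⟨⟨a.1, ha⟩, z, rfl, hz, hxz.mono ?_⟩
  intro c e hce
  rw [openGraph_adj, mem_finsetRestrict_iff, edgeLift_mk] at hce ⊢
  refine ⟨⟨hce.1, ?_⟩, hce.2⟩
  have hadj : (finsetGraph G S).Adj (finsetIncl h c) (finsetIncl h e) := (mem_edgeSet _).1 (hωE hce.1)
  exact Finset.mem_coe.2 (mk_mem_insideEdges h hadj c.2 e.2)

/-- **Between the pieces the path uses no inside edge**: if `ω` joins a vertex of `Λ₀` to a vertex
of `Λ₁`, then some vertex of `Λ₀` is joined to some vertex of `Λ₁` by an `ω`-open path using no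
inside edge of `Λ₀` or `Λ₁` (the piece of the path between its last visit to `Λ₀` and its next visit
to `Λ₁`). [folklore] -/
theorem exists_reachable_inter_compl_insideEdges [DecidableEq V] [DecidableRel G.Adj] {Λ₀ Λ₁ S : Finset V} (h₀ : Λ₀ ⊆ S) (h₁ : Λ₁ ⊆ S)
    {ω : BondConfig ↥S} {a b : ↥S} (ha : a.1 ∈ Λ₀) (hb : b.1 ∈ Λ₁) (hab : (openGraph ω).Reachable a b) :
    ∃ v w : ↥S, v.1 ∈ Λ₀ ∧ w.1 ∈ Λ₁ ∧
      (openGraph (ω ∩ (↑(insideEdges G h₀ ∪ insideEdges G h₁) : Set (Sym2 ↥S))ᶜ)).Reachable v w := by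
  classical
  obtain ⟨p⟩ := hab.symm
  -- last visit to `Λ₀`: a path from `b` back to a vertex `v` of `Λ₀`, off `Λ₀`
  obtain ⟨v, hv, hbv⟩ := exists_mem_reachable_inf_fromRel' {u : ↥S | u.1 ∈ Λ₀} p ha
  obtain ⟨p'⟩ := hbv.symm
  -- then the first visit to `Λ₁` along it
  obtain ⟨w, hw, hvw⟩ := exists_mem_reachable_inf_fromRel' {u : ↥S | u.1 ∈ Λ₁} p' hb
  refine ⟨v, w, hv, hw, hvw.mono ?_⟩
  intro c e hce
  rw [inf_adj, inf_adj, fromRel_adj, fromRel_adj, openGraph_adj] at hce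
  obtain ⟨⟨⟨hmem, hne⟩, -, hout₀⟩, -, hout₁⟩ := hce
  rw [openGraph_adj]
  refine ⟨⟨hmem, ?_⟩, hne⟩
  rw [Set.mem_compl_iff, Finset.mem_coe, Finset.mem_union, not_or]
  constructor
  · intro he
    rcases hout₀ with hc | hc
    · exact hc (mem_of_mem_insideEdges h₀ he (Sym2.mem_mk_left c e))
    · exact hc (mem_of_mem_insideEdges h₀ he (Sym2.mem_mk_right c e))
  · intro he
    rcases hout₁ with hc | hc
    · exact hc (mem_of_mem_insideEdges h₁ he (Sym2.mem_mk_left c e))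
    · exact hc (mem_of_mem_insideEdges h₁ he (Sym2.mem_mk_right c e))

/-! ### Two pieces -/

/-- **Two-piece arm bound** (two successive conditionings, Duminil-Copin–Smirnov 2012, §6.1, with
the wired boundary condition maximal, Grimmett 2006, Lemma (4.14)(b); the decoupling of Kesten 1986,
proof of Thm. 3). Let `Λ₀ ∋ x₀`, `Λ₁ ∋ x₁` be disjoint sub-pieces of the finite piece `S` of `G`,
with nonempty inner boundaries, `0 ≤ p ≤ 1`, `q ≥ 1`. Then
`φ¹_S(x₀ ↔ x₁) ≤ φ¹_{Λ₀}(x₀ ↔ ∂Λ₀) · φ¹_{Λ₁}(x₁ ↔ ∂Λ₁) · φ¹_S(∃ v ∈ Λ₀, w ∈ Λ₁, v ↔ w)`.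
[cite: Grimmett2006, Lemma (4.13) and Lemma (4.14)(b); DuminilCopinSmirnov2012Clay, §6.1] -/
theorem rcMeasure_real_sitePair_le_mul_mul [DecidableEq V] [DecidableRel G.Adj] [G.LocallyFinite] {p q : ℝ} (hp : p ∈ Set.Icc (0 : ℝ) 1) (hq : 1 ≤ q)
    {Λ₀ Λ₁ S : Finset V} (h₀ : Λ₀ ⊆ S) (h₁ : Λ₁ ⊆ S) (hdisj : Disjoint Λ₀ Λ₁)
    (hΛ₀ : (wiredBoundary G Λ₀).Nonempty) (hΛ₁ : (wiredBoundary G Λ₁).Nonempty)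
    {x₀ x₁ : V} (hx₀ : x₀ ∈ Λ₀) (hx₁ : x₁ ∈ Λ₁) :
    (rcMeasure (finsetGraph G S) p q (wiredBoundary G S)).real
        {ω | ∃ a b : ↥S, a.1 = x₀ ∧ b.1 = x₁ ∧ (openGraph ω).Reachable a b} ≤
      (rcMeasure (finsetGraph G Λ₀) p q (wiredBoundary G Λ₀)).real
          {ζ | ∃ a y : ↥Λ₀, a.1 = x₀ ∧ y ∈ wiredBoundary G Λ₀ ∧ (openGraph ζ).Reachable a y} *
      ((rcMeasure (finsetGraph G Λ₁) p q (wiredBoundary G Λ₁)).real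
          {ζ | ∃ a y : ↥Λ₁, a.1 = x₁ ∧ y ∈ wiredBoundary G Λ₁ ∧ (openGraph ζ).Reachable a y} *
        (rcMeasure (finsetGraph G S) p q (wiredBoundary G S)).real
          {ω | ∃ v w : ↥S, v.1 ∈ Λ₀ ∧ w.1 ∈ Λ₁ ∧ (openGraph ω).Reachable v w}) := by
  classical
  have hq0 : 0 < q := one_pos.trans_le hq
  haveI := isProbabilityMeasure_rcMeasure (finsetGraph G S) hp hq0 (wiredBoundary G S)
  set μ := rcMeasure (finsetGraph G S) p q (wiredBoundary G S) with hμ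
  set U₀ := insideEdges G h₀ with hU₀
  set U₁ := insideEdges G h₁ with hU₁
  -- the events
  set A₀ : Set (BondConfig ↥S) := {ω | ω ∩ ↑U₀ ∈ finsetRestrict h₀ ⁻¹'
    {ζ | ∃ a y : ↥Λ₀, a.1 = x₀ ∧ y ∈ wiredBoundary G Λ₀ ∧ (openGraph ζ).Reachable a y}} with hA₀
  set A₁ : Set (BondConfig ↥S) := {ω | ω ∩ ↑U₁ ∈ finsetRestrict h₁ ⁻¹'
    {ζ | ∃ a y : ↥Λ₁, a.1 = x₁ ∧ y ∈ wiredBoundary G Λ₁ ∧ (openGraph ζ).Reachable a y}} with hA₁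
  set C : Set (BondConfig ↥S) :=
    {ω | ∃ v w : ↥S, v.1 ∈ Λ₀ ∧ w.1 ∈ Λ₁ ∧ (openGraph ω).Reachable v w} with hC
  set F : Set (BondConfig ↥S) := {ω | ω ∩ (↑(U₀ ∪ U₁) : Set (Sym2 ↥S))ᶜ ∈ C} with hF
  have hCup : IsUpperSet C := by
    rintro ω ω' hle ⟨v, w, hv, hw, hvw⟩
    exact ⟨v, w, hv, hw, hvw.mono (fromEdgeSet_mono hle)⟩
  -- disjointness of the regions
  have hdU : Disjoint U₀ U₁ := disjoint_insideEdges_of_disjoint h₀ h₁ hdisj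
  have hU₁c : (↑U₁ : Set (Sym2 ↥S)) ⊆ (↑U₀)ᶜ := fun e he heU => Finset.disjoint_left.1 hdU heU he
  have hUUc₀ : (↑(U₀ ∪ U₁) : Set (Sym2 ↥S))ᶜ ⊆ (↑U₀)ᶜ := by
    rw [Finset.coe_union]; exact Set.compl_subset_compl.2 Set.subset_union_left
  have hUUc₁ : (↑(U₀ ∪ U₁) : Set (Sym2 ↥S))ᶜ ⊆ (↑U₁)ᶜ := by
    rw [Finset.coe_union]; exact Set.compl_subset_compl.2 Set.subset_union_right
  -- step 0: inclusion of events on configurations of the edges of `S`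
  have hx₁' : x₁ ∉ Λ₀ := fun hmem => Finset.disjoint_left.1 hdisj hmem hx₁
  have hx₀' : x₀ ∉ Λ₁ := fun hmem => Finset.disjoint_left.1 hdisj hx₀ hmem
  have h0 : μ.real {ω | ∃ a b : ↥S, a.1 = x₀ ∧ b.1 = x₁ ∧ (openGraph ω).Reachable a b} ≤
      μ.real (A₀ ∩ (A₁ ∩ F)) := by
    refine rcMeasure_real_mono_on_edgeSets _ hp hq0 _ fun ω hωE hω => ?_
    obtain ⟨a, b, ha, hb, hab⟩ := hω
    subst ha hb
    exact ⟨inter_insideEdges_mem_pieceArm h₀ hωE hx₀ hx₁' hab,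
      inter_insideEdges_mem_pieceArm h₁ hωE hx₁ hx₀' hab.symm,
      exists_reachable_inter_compl_insideEdges h₀ h₁ hx₀ hx₁ hab⟩
  -- step 1: condition on the configuration off `Λ₀`
  have hF1 : ∀ ω₁ ω₂ : BondConfig ↥S, ω₁ ∩ (↑U₀)ᶜ = ω₂ ∩ (↑U₀)ᶜ → (ω₁ ∈ A₁ ∩ F ↔ ω₂ ∈ A₁ ∩ F) := by
    intro ω₁ ω₂ hω
    have e1 : ω₁ ∩ ↑U₁ = ω₂ ∩ ↑U₁ := inter_eq_inter_of_subset_compl' hU₁c hω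
    have e2 := inter_eq_inter_of_subset_compl' hUUc₀ hω
    simp only [hA₁, hF, Set.mem_inter_iff, Set.mem_setOf_eq, Set.mem_preimage]
    rw [e1, e2]
  have h1 := rcMeasure_real_pieceArm_inter_le_mul hp hq h₀ hΛ₀ x₀ hF1
  -- step 2: condition on the configuration off `Λ₁`
  have hF2 : ∀ ω₁ ω₂ : BondConfig ↥S, ω₁ ∩ (↑U₁)ᶜ = ω₂ ∩ (↑U₁)ᶜ → (ω₁ ∈ F ↔ ω₂ ∈ F) := by
    intro ω₁ ω₂ hω
    have e2 := inter_eq_inter_of_subset_compl' hUUc₁ hω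
    simp only [hF, Set.mem_setOf_eq]
    rw [e2]
  have h2 := rcMeasure_real_pieceArm_inter_le_mul hp hq h₁ hΛ₁ x₁ hF2
  -- step 3: drop the restriction to the edges off the pieces
  have h3 : μ.real F ≤ μ.real C :=
    measureReal_mono (fun ω hω => hCup Set.inter_subset_left hω) (measure_ne_top _ _)
  calc μ.real {ω | ∃ a b : ↥S, a.1 = x₀ ∧ b.1 = x₁ ∧ (openGraph ω).Reachable a b}
      ≤ μ.real (A₀ ∩ (A₁ ∩ F)) := h0
    _ ≤ _ := h1
    _ ≤ _ := mul_le_mul_of_nonneg_left (h2.trans (mul_le_mul_of_nonneg_left h3 measureReal_nonneg))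
        measureReal_nonneg

end Pieces

/-! ### Translated boxes of `ℤ^d` -/

section Boxes

variable {d : ℕ}

/-- The wired boundary of a translated box `x + Λ_N` is nonempty (`d ≥ 1`). [folklore] -/
theorem wiredBoundary_icc_shift_nonempty (hd : 0 < d) (x : Site d) (N : ℕ) :
    (wiredBoundary (zdGraph d) (Finset.Icc (fun i => -(N : ℤ) + x i) (fun i => (N : ℤ) + x i))).Nonempty := by
  obtain ⟨v, hv⟩ := innerBoundary_Icc_nonempty hd (a := fun i => -(N : ℤ) + x i)
    (b := fun i => (N : ℤ) + x i) (fun i => by simp only; omega)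
  exact ⟨⟨v, (mem_innerBoundary_iff.1 hv).1⟩, hv⟩

/-- Translated boxes of radius `N` around `x` and `x + M eᵢ` are disjoint once `M > 2N`.
[folklore] -/
theorem disjoint_icc_shift_add_single (x : Site d) (i : Fin d) {N : ℕ} {M : ℤ} (hM : 2 * (N : ℤ) < M) :
    Disjoint (Finset.Icc (fun j => -(N : ℤ) + x j) (fun j => (N : ℤ) + x j))
      (Finset.Icc (fun j => -(N : ℤ) + (x + Pi.single i M : Site d) j) (fun j => (N : ℤ) + (x + Pi.single i M : Site d) j)) := by
  rw [Finset.disjoint_left]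
  intro y hy hy'
  have h1 := (mem_siteIcc_iff.1 hy i).2
  have h2 := (mem_siteIcc_iff.1 hy' i).1
  rw [Pi.add_apply, Pi.single_eq_same] at h2
  omega

/-- **Two-box arm bound on `ℤ^d`** (Grimmett 2006, Lemma (4.14)(b) with translation invariance,
§4.3): for two disjoint translated boxes `x₀ + Λ_N`, `x₁ + Λ_N ⊆ S` of a finite piece `S` of `ℤ^d`
(`d ≥ 1`, `0 ≤ p ≤ 1`, `q ≥ 1`),
`φ¹_S(x₀ ↔ x₁) ≤ φ¹_{Λ_N}(0 ↔ ∂Λ_N)² · φ¹_S(∃ v ∈ x₀ + Λ_N, w ∈ x₁ + Λ_N, v ↔ w)`.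
[cite: Grimmett2006, Lemma (4.14)(b) and §4.3] -/
theorem rcMeasure_real_sitePair_le_thetaWiredBox_sq_mul (hd : 0 < d) {p q : ℝ}
    (hp : p ∈ Set.Icc (0 : ℝ) 1) (hq : 1 ≤ q) {S : Finset (Site d)} {x₀ x₁ : Site d} {N : ℕ}
    (h₀ : Finset.Icc (fun i => -(N : ℤ) + x₀ i) (fun i => (N : ℤ) + x₀ i) ⊆ S)
    (h₁ : Finset.Icc (fun i => -(N : ℤ) + x₁ i) (fun i => (N : ℤ) + x₁ i) ⊆ S)
    (hdisj : Disjoint (Finset.Icc (fun i => -(N : ℤ) + x₀ i) (fun i => (N : ℤ) + x₀ i))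
      (Finset.Icc (fun i => -(N : ℤ) + x₁ i) (fun i => (N : ℤ) + x₁ i))) :
    (rcMeasure (finsetGraph (zdGraph d) S) p q (wiredBoundary (zdGraph d) S)).real
        {ω | ∃ a b : ↥S, a.1 = x₀ ∧ b.1 = x₁ ∧ (openGraph ω).Reachable a b} ≤
      thetaWiredBox d p q N ^ 2 *
        (rcMeasure (finsetGraph (zdGraph d) S) p q (wiredBoundary (zdGraph d) S)).real
          {ω | ∃ v w : ↥S, v.1 ∈ Finset.Icc (fun i => -(N : ℤ) + x₀ i) (fun i => (N : ℤ) + x₀ i) ∧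
            w.1 ∈ Finset.Icc (fun i => -(N : ℤ) + x₁ i) (fun i => (N : ℤ) + x₁ i) ∧
            (openGraph ω).Reachable v w} := by
  have hq0 : 0 < q := one_pos.trans_le hq
  have key := rcMeasure_real_sitePair_le_mul_mul (G := zdGraph d) hp hq h₀ h₁ hdisj
    (wiredBoundary_icc_shift_nonempty hd x₀ N) (wiredBoundary_icc_shift_nonempty hd x₁ N)
    (centre_mem_icc_shift x₀ N) (centre_mem_icc_shift x₁ N)
  refine key.trans ?_
  have hθ₀ := rcMeasure_real_siteArm_icc_shift_le_thetaWiredBox hp hq0 x₀ N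
  have hθ₁ := rcMeasure_real_siteArm_icc_shift_le_thetaWiredBox hp hq0 x₁ N
  rw [sq, mul_assoc]
  refine mul_le_mul hθ₀ (mul_le_mul_of_nonneg_right hθ₁ measureReal_nonneg) ?_ measureReal_nonneg
  exact mul_nonneg measureReal_nonneg measureReal_nonneg

end Boxes

end Literature.Probability.LatticeModels

end
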